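import Literature.Geometry.Riemannian.HeatKernelSubsolution
import Literature.Geometry.Riemannian.HeatGradientSubsolution
import HarnessLib

/-!
# The Hein–Naber `L²`-Poincaré inequality for the conjugate heat kernel measures of a Ricci flow
# (Hein–Naber 2014, Thm. 1.10; Bamler 2020a, Thm. 11.1, `p = 2`)

H.-J. Hein, A. Naber, *New logarithmic Sobolev inequalities and an ε-regularity theorem for the
Ricci flow*, Comm. Pure Appl. Math. 67 (2014), Thm. 1.10, and R. Bamler, *Entropy and heat kernel
bounds on a Ricci flow background*, arXiv:2008.07093 (2020a), §11, Thm. 11.1 (the case `p = 2`,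
`C(2) = 2`): for a Ricci flow on a closed manifold and the conjugate heat kernel measures
`dν = dν_{x,t;s} = K(x,t;·,s) dg_s`, `s < t`, every `φ ∈ C¹(M)` satisfies

  `∫ (φ − ∫ φ dν)² dν ≤ 2 (t − s) ∫ |∇φ|²_{g_s} dν`.

This file proves it (for `C^∞` test functions `φ`) for a Ricci flow `hflow = (h, cov)` on
`[a, T]` of a `C^∞` family of Riemannian metrics on a closed connected manifold `M` (modelled on
`ℝᵐ`), `a < s < t ≤ T`, with the tree's heat kernel measures
`ν_{x,t;s} = heatKernelMeasure hh hR t x s` (`HeatKernelMeasures.lean`), by the semigroup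
(Bakry–Émery / Hein–Naber §3.1) argument:

* `gradSq_heat_le_integral_gradSq_heatKernelMeasure` — **Hein–Naber's gradient bound
  `|∇P f|² ≤ P(|∇f|²)`**: for a solution `u` of the heat equation `∂ᵣu = Δ_{h(r)}u` on
  `M × [s, t]` and `r ∈ (s, t]`, `|∇u(r)|²_{h(r)}(x) ≤ ∫ |∇u(s)|²_{h(s)} dν_{x,r;s}` (the Bochner
  inequality `(∂ᵣ − Δ)|∇u|² = −2|Hess u|² ≤ 0`, `derivWithin_gradSq_le_of_heat_ricciFlow`, and the
  domination of sub-solutions by the heat kernel measures,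
  `integral_heatKernelMeasure_anti_of_subsolution`);
* `heinNaber_poincare_heatKernelMeasure` — **the Poincaré inequality** above: with `u = P φ`
  and `ψ = P|∇φ|²` the heat solutions from `φ`, `|∇φ|²_{h(s)}` at time `s`, the function
  `w = −u² − 2(r − s)ψ` satisfies `(∂ᵣ − Δ)w = 2|∇u|² − 2ψ ≤ 0` by the gradient bound, so
  `w(x, t) ≤ ∫ w(s) dν_{x,t;s}`, i.e. `∫ φ² dν − (∫ φ dν)² ≤ 2(t − s) ∫ |∇φ|² dν`
  (`u(x,t) = ∫ φ dν`, `ψ(x,t) = ∫ |∇φ|² dν` by the representation formula).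

Everything is proved; no definitions, no named facts. What is NOT here: the `Lᵖ` versions
`p ≠ 2` of Bamler's Thm. 11.1, the log-Sobolev inequality / Gaussian concentration
(Hein–Naber Thm. 1.10 (1.14), Bamler Thm. 11.2–12.1), test functions of lower regularity
(`C¹`, Lipschitz), super Ricci flows and non-compact `M`.

## References

* H.-J. Hein, A. Naber, *New logarithmic Sobolev inequalities and an ε-regularity theorem for the
  Ricci flow*, Comm. Pure Appl. Math. 67 (2014), 1543–1561, Thm. 1.10 and §3.1. [HeinNaber2014]
* R. H. Bamler, *Entropy and heat kernel bounds on a Ricci flow background*, arXiv:2008.07093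
  (2020), §4.2 (proof of Thm. 4.1), §11, Thm. 11.1. [Bamler2020Entropy]
* D. Bakry, M. Émery, *Diffusions hypercontractives*, Sém. Probab. XIX, LNM 1123 (1985).
  [BakryEmery1985]
-/

noncomputable section

open Bundle Set Function Filter Manifold MeasureTheory Measure TopologicalSpace
open scoped Manifold ContDiff Topology ENNReal NNReal

namespace Literature.Geometry.Riemannian

open Lorentzian Lorentzian.PseudoRiemannianMetric

section Poincare

variable {m : ℕ} {H : Type*} [TopologicalSpace H]
  {I : ModelWithCorners ℝ (EuclideanSpace ℝ (Fin m)) H} [I.Boundaryless]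
  {M : Type*} [TopologicalSpace M] [ChartedSpace H M] [IsManifold I ∞ M]
  [T2Space M] [CompactSpace M] [SecondCountableTopology M] [MeasurableSpace M] [BorelSpace M]
  [PreconnectedSpace M]
  {h : ℝ → PseudoRiemannianMetric I ∞ (EuclideanSpace ℝ (Fin m)) (TangentSpace I : M → Type _)}
  {cov : ℝ → CovariantDerivative I (EuclideanSpace ℝ (Fin m)) (TangentSpace I : M → Type _)}
  {a T : ℝ}

omit [I.Boundaryless] [T2Space M] [CompactSpace M] [SecondCountableTopology M] [MeasurableSpace M]
  [BorelSpace M] [PreconnectedSpace M] in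
/-- **The Laplacian of a square**: `Δ_g(f²)(x) = 2|∇f|²_g(x) + 2 f(x) Δ_g f(x)` for `f` of class
`C²` at `x` (the chain rule `Δ(ζ ∘ f) = ζ''(f)|∇f|² + ζ'(f)Δf`, `dalembertian_real_comp`, with
`ζ(v) = v²`). [folklore] -/
private theorem laplaceBeltrami_fun_sq
    (g : PseudoRiemannianMetric I ∞ (EuclideanSpace ℝ (Fin m)) (TangentSpace I : M → Type _))
    {f : M → ℝ} {x : M} (hf : ContMDiffAt I 𝓘(ℝ, ℝ) 2 f x) :
    g.laplaceBeltrami (fun y ↦ f y ^ 2) x = 2 * g.gradSq f x + 2 * f x * g.laplaceBeltrami f x := by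
  haveI := g.hasLeviCivita
  have hζ : ContDiffAt ℝ 2 (fun v : ℝ ↦ v ^ 2) (f x) := contDiffAt_id.pow 2
  have h1 : deriv (fun v : ℝ ↦ v ^ 2) = fun v ↦ 2 * v := by
    funext v
    simp
  have h2 : deriv (deriv (fun v : ℝ ↦ v ^ 2)) (f x) = 2 := by
    rw [h1, ((hasDerivAt_id' (f x)).const_mul (2 : ℝ)).deriv, mul_one]
  rw [laplaceBeltrami_eq_dalembertian, laplaceBeltrami_eq_dalembertian,
    show (fun y ↦ f y ^ 2) = (fun v : ℝ ↦ v ^ 2) ∘ f from rfl, g.dalembertian_real_comp hf hζ, h2,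
    h1]
  simp only [PseudoRiemannianMetric.gradSq]

/-- **Hein–Naber's gradient bound `|∇P f|² ≤ P(|∇f|²)` for the heat equation coupled with a Ricci
flow** (Hein–Naber 2014, §3.1, proof of Thm. 1.10; Bamler 2020a, §4.2): for a Ricci flow
`(h, cov)` on `[a, T]` of a smooth family of Riemannian metrics on a closed connected manifold,
`a < s < t ≤ T`, a smooth solution `u` of the heat equation `∂ᵣu = Δ_{h(r)}u` on `M × [s, t]`,
`r ∈ (s, t]` and `x ∈ M`,

  `|∇u(r)|²_{h(r)}(x) ≤ ∫ |∇u(s)|²_{h(s)} dν_{x,r;s}`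

(`|∇u|²` is a sub-solution of the heat equation, `(∂ᵣ − Δ)|∇u|² = −2|Hess u|² ≤ 0` by Bochner's
identity under the flow, `derivWithin_gradSq_le_of_heat_ricciFlow`, and sub-solutions are
dominated by the heat kernel measures, `integral_heatKernelMeasure_anti_of_subsolution` with
`ν_{x,r;r} = δ_x`). [cite: HeinNaber2014, §3.1, proof of Thm. 1.10]
[cite: Bamler2020Entropy, §4.2, proof of Thm. 4.1] -/
theorem gradSq_heat_le_integral_gradSq_heatKernelMeasure (hflow : IsRicciFlow h cov (Icc a T))
    (hh : IsContMDiffFamilyOn ∞ h univ) (hR : ∀ r, (h r).IsRiemannian) {s t : ℝ} (has : a < s)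
    (htT : t ≤ T) {u : ℝ → M → ℝ} (hu : IsHeatSolutionOn h u s t) {r : ℝ} (hr : r ∈ Ioc s t)
    (x : M) :
    (h r).gradSq (u r) x ≤ ∫ y, (h s).gradSq (u s) y ∂(heatKernelMeasure hh hR r x s) := by
  have hsr : s < r := hr.1
  -- the flow and the solution restricted to `[s, r]`
  have hu' : IsHeatSolutionOn h u s r := hu.mono le_rfl hr.2
  have hflow' : IsRicciFlow h cov (Icc s r) :=
    hflow.mono (Icc_subset_Icc has.le (hr.2.trans htT))
  have hU : UniqueDiffOn ℝ (Icc s r) := uniqueDiffOn_Icc hsr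
  -- `w(r', y) = |∇u(r')|²_{h(r')}(y)` is a smooth sub-solution of the heat equation on `M × [s, r]`
  have hW : ContMDiffOn (I.prod 𝓘(ℝ, ℝ)) 𝓘(ℝ, ℝ) ∞
      (fun p : M × ℝ ↦ (h p.2).gradSq (u p.2) p.1) (univ ×ˢ Icc s r) :=
    hflow'.smooth.contMDiffOn_gradSq hU hu'.1
  have hWsub : ∀ r' ∈ Icc s r, ∀ y : M,
      derivWithin (fun r'' ↦ (h r'').gradSq (u r'') y) (Icc s r) r' ≤
        (h r').laplaceBeltrami ((h r').gradSq (u r')) y := fun r' hr' y ↦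
    derivWithin_gradSq_le_of_heat_ricciFlow hsr hflow' (fun r'' _ ↦ hR r'') hu'.1 hu'.2 hr' y
  have key := integral_heatKernelMeasure_anti_of_subsolution hflow hh hR
    ⟨has.trans hsr, hr.2.trans htT⟩ x has hsr le_rfl (w := fun r' y ↦ (h r').gradSq (u r') y)
    hW hWsub
  rwa [heatKernelMeasure_self, integral_dirac] at key

/-- **The Hein–Naber `L²`-Poincaré inequality for the conjugate heat kernel measures of a Ricci
flow** (Hein–Naber 2014, Thm. 1.10; Bamler 2020a, Thm. 11.1 for `p = 2`, `C(2) = 2`): for a Ricci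
flow `(h, cov)` on `[a, T]` of a smooth family of Riemannian metrics on a closed connected
manifold `M`, `a < s < t ≤ T`, `x ∈ M`, the conjugate heat kernel measure `ν = ν_{x,t;s}` and a
smooth `φ : M → ℝ`,

  `∫ (φ − ∫ φ dν)² dν ≤ 2 (t − s) ∫ |∇φ|²_{h(s)} dν`.

Proof (the semigroup argument of Hein–Naber §3.1 / Bakry–Émery): let `u`, `ψ` be the heat
solutions on `M × [s, t]` with `u(s) = φ`, `ψ(s) = |∇φ|²_{h(s)}`; by the gradient bound
`gradSq_heat_le_integral_gradSq_heatKernelMeasure` and the representation formula,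
`|∇u(r)|² ≤ ψ(r)` on `M × [s, t]`, so `w = −u² − 2(r − s)ψ` satisfies
`(∂ᵣ − Δ_{h(r)})w = 2|∇u|² − 2ψ ≤ 0` (`Δ(u²) = 2|∇u|² + 2uΔu`), whence
`w(x, t) ≤ ∫ w(s) dν_{x,t;s}` (`integral_heatKernelMeasure_anti_of_subsolution`), i.e.
`∫ φ² dν − u(x,t)² ≤ 2(t − s) ψ(x, t)` with `u(x, t) = ∫ φ dν`, `ψ(x, t) = ∫ |∇φ|² dν`
(`IsHeatSolutionOn.eq_integral_heatKernelMeasure`); finally `∫ (φ − c)² dν = ∫ φ² dν − c²` for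
`c = ∫ φ dν` (`ν` is a probability measure). [cite: HeinNaber2014, Thm. 1.10]
[cite: Bamler2020Entropy, §11, Thm. 11.1] -/
theorem heinNaber_poincare_heatKernelMeasure (hflow : IsRicciFlow h cov (Icc a T))
    (hh : IsContMDiffFamilyOn ∞ h univ) (hR : ∀ r, (h r).IsRiemannian) {s t : ℝ} (has : a < s)
    (hst : s < t) (htT : t ≤ T) (x : M) {φ : M → ℝ} (hφ : ContMDiff I 𝓘(ℝ, ℝ) ∞ φ) :
    ∫ y, (φ y - ∫ z, φ z ∂(heatKernelMeasure hh hR t x s)) ^ 2 ∂(heatKernelMeasure hh hR t x s) ≤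
      2 * (t - s) * ∫ y, (h s).gradSq φ y ∂(heatKernelMeasure hh hR t x s) := by
  have h2le : (2 : ℕ∞ω) ≤ ((⊤ : ℕ∞) : ℕ∞ω) := WithTop.coe_le_coe.mpr le_top
  have hU : UniqueDiffOn ℝ (Icc s t) := uniqueDiffOn_Icc hst
  -- `|∇φ|²_{h(s)}` is smooth
  have hGφ : ContMDiff I 𝓘(ℝ, ℝ) ∞ ((h s).gradSq φ) := by
    have hf : ContMDiffOn (I.prod 𝓘(ℝ, ℝ)) 𝓘(ℝ, ℝ) ∞ (fun p : M × ℝ ↦ φ p.1)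
        (univ ×ˢ (univ : Set ℝ)) := (hφ.comp contMDiff_fst).contMDiffOn
    exact contMDiff_slice_of_contMDiffOn (u := fun r y ↦ (h r).gradSq φ y)
      (hh.contMDiffOn_gradSq uniqueDiffOn_univ (f := fun _ y ↦ φ y) hf) (mem_univ s)
  -- the heat solutions `u = Pφ` and `ψ = P|∇φ|²` on `M × [s, t]`
  obtain ⟨u, hu, hus⟩ := exists_isHeatSolutionOn hh hR hst hφ
  obtain ⟨ψ, hψ, hψs⟩ := exists_isHeatSolutionOn hh hR hst hGφ
  -- (1) the gradient bound `|∇u(r)|² ≤ ψ(r)` on `M × [s, t]`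
  have hgradle : ∀ r ∈ Icc s t, ∀ y : M, (h r).gradSq (u r) y ≤ ψ r y := by
    intro r hr y
    rcases eq_or_lt_of_le hr.1 with heq | hsr
    · subst heq
      rw [hψs, hus]
    · have h1 := gradSq_heat_le_integral_gradSq_heatKernelMeasure hflow hh hR has htT hu
        ⟨hsr, hr.2⟩ y
      rw [hus, ← hψs, ← (hψ.mono le_rfl hr.2).eq_integral_heatKernelMeasure hh hR hsr y] at h1
      exact h1
  -- (2) `w = −u² − 2(r − s)ψ` is a smooth sub-solution of the heat equation on `M × [s, t]`
  have hwsmooth : ContMDiffOn (I.prod 𝓘(ℝ, ℝ)) 𝓘(ℝ, ℝ) ∞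
      (fun p : M × ℝ ↦ -(u p.2 p.1 ^ 2) + -2 * (p.2 - s) * ψ p.2 p.1) (univ ×ˢ Icc s t) := by
    have hl : ContMDiffOn (I.prod 𝓘(ℝ, ℝ)) 𝓘(ℝ, ℝ) ∞ (fun p : M × ℝ ↦ -2 * (p.2 - s))
        (univ ×ˢ Icc s t) := (contMDiff_const.mul (contMDiff_snd.sub contMDiff_const)).contMDiffOn
    exact (hu.1.pow 2).neg.add (hl.mul hψ.1)
  have hwsub : ∀ r ∈ Icc s t, ∀ y : M,
      derivWithin (fun r' ↦ -(u r' y ^ 2) + -2 * (r' - s) * ψ r' y) (Icc s t) r ≤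
        (h r).laplaceBeltrami (fun y ↦ -(u r y ^ 2) + -2 * (r - s) * ψ r y) y := by
    intro r hr y
    have hur : ContMDiffAt I 𝓘(ℝ, ℝ) 2 (u r) y := ((hu.contMDiff_slice hr).of_le h2le).contMDiffAt
    have hψr : ContMDiffAt I 𝓘(ℝ, ℝ) 2 (ψ r) y := ((hψ.contMDiff_slice hr).of_le h2le).contMDiffAt
    -- the time derivative
    have hlin : HasDerivWithinAt (fun r' : ℝ ↦ -2 * (r' - s)) (-2 * 1) (Icc s t) r :=
      ((hasDerivWithinAt_id r _).sub_const s).const_mul (-2)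
    have hd := ((hu.2 r hr y).fun_pow 2).fun_neg.fun_add (hlin.fun_mul (hψ.2 r hr y))
    rw [hd.derivWithin (hU r hr)]
    -- the Laplacian
    have hΔ : (h r).laplaceBeltrami (fun y ↦ -(u r y ^ 2) + -2 * (r - s) * ψ r y) y =
        -(2 * (h r).gradSq (u r) y + 2 * u r y * (h r).laplaceBeltrami (u r) y) +
          -2 * (r - s) * (h r).laplaceBeltrami (ψ r) y := by
      rw [laplaceBeltrami_fun_add (h r) (f₁ := fun y ↦ -(u r y ^ 2))
          (f₂ := fun y ↦ -2 * (r - s) * ψ r y) (hur.pow 2).neg (contMDiffAt_const.mul hψr),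
        laplaceBeltrami_const_mul (h r) hψr,
        show (fun y ↦ -(u r y ^ 2)) = -(fun y ↦ u r y ^ 2) from rfl, laplaceBeltrami_neg,
        laplaceBeltrami_fun_sq (h r) hur]
    rw [hΔ]
    have hg := hgradle r hr y
    push_cast
    nlinarith [hg]
  -- (3) domination of the sub-solution `w` by the heat kernel measures: `w(x,t) ≤ ∫ w(s) dν`
  have key := integral_heatKernelMeasure_anti_of_subsolution hflow hh hR ⟨has.trans hst, htT⟩ x
    has hst le_rfl (w := fun r' y ↦ -(u r' y ^ 2) + -2 * (r' - s) * ψ r' y) hwsmooth hwsub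
  rw [heatKernelMeasure_self, integral_dirac, hu.eq_integral_heatKernelMeasure hh hR hst x,
    hψ.eq_integral_heatKernelMeasure hh hR hst x, hus, hψs] at key
  simp only [sub_self, mul_zero, zero_mul, add_zero, integral_neg] at key
  -- (4) `∫ (φ − c)² dν = ∫ φ² dν − c²`, `c = ∫ φ dν`
  set ν := heatKernelMeasure hh hR t x s with hν
  have hφi : Integrable φ ν :=
    hφ.continuous.integrable_of_hasCompactSupport (HasCompactSupport.of_compactSpace _)
  have hφ2i : Integrable (fun y ↦ φ y ^ 2) ν :=
    (hφ.continuous.pow 2).integrable_of_hasCompactSupport (HasCompactSupport.of_compactSpace _)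
  set c : ℝ := ∫ z, φ z ∂ν with hc
  have hexp : ∫ y, (φ y - c) ^ 2 ∂ν = ∫ y, φ y ^ 2 ∂ν - c ^ 2 := by
    have e : (fun y ↦ (φ y - c) ^ 2) = fun y ↦ φ y ^ 2 - 2 * c * φ y + c ^ 2 := by
      funext y
      ring
    have i0 : Integrable (fun y ↦ 2 * c * φ y) ν := hφi.const_mul _
    have i1 : Integrable (fun y ↦ φ y ^ 2 - 2 * c * φ y) ν := hφ2i.sub i0
    have i2 : Integrable (fun _ : M ↦ c ^ 2) ν := integrable_const _
    rw [e, integral_add i1 i2, integral_sub hφ2i i0, integral_const_mul, integral_const]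
    simp only [smul_eq_mul, probReal_univ, one_mul]
    rw [← hc]
    ring
  rw [hexp]
  linarith

end Poincare

end Literature.Geometry.Riemannian
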